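import Summits.QuantumFields.BalabanUV.Beta.FP.NestedStepLawMovingBorder

/-!
# `BalabanUV.Beta.FP.SecondVarPolarisation` — road «FP» for binder row D1, RULING R-FP-48 ∕ design «ROUTE T» (owner, gen 16): THE MIXED (TWO-BOND) ONE-LOOP
# FUNCTIONAL `mixedVar A₀ A_b A_b′ A_bb′ := tr(A₀⁻¹A_bb′) − tr(A₀⁻¹A_b A₀⁻¹A_b′)` AND ITS POLARISATION FROM `secondVar` — so that every ONE-direction identity
# of the model (`secondVar_nestedStepLaw_movingBorder(_explicit)`, `sixLoops_kkt`) yields the TWO-bond identity the road's kernels `TP μ ν z` are read as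

HONEST DEPENDENCY (page 1, mandatory): continuum YM on T⁴ ⇐ BetaPertH ∧ nine spine estimates (0/9 proved); BetaPertH ⇐ (D1) ∧ (D4) ∧ CAP+tail;
G-an2-4 gates asym, D1 and NE2/3/4.  HONEST FRAMING (cell contract, verbatim): «discharging `BetaPertH` makes Bałaban's UV stability UNCONDITIONAL —
a real constructive-QFT result; it is NOT the continuum limit and NOT the Clay problem.»  THIS MODULE is [folklore] trace algebra (`Matrix.trace_mul_comm`); ONE
definition by abbreviation of a polynomial in matrices (`mixedVar`, the two-slot twin of road BF-x's `secondVar`; asserts nothing), no `def … : Prop`, nothing cited,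
0 sorry; 0∕4 row-D1 binders; NOT SDF, NOT D1, NOT BetaPertH, NOT continuum, NOT Clay.  «not in print; our bookkeeping».

ABSOLUTE RULE (cell charter, verbatim): «No internally-minted statement may enter as a cited fact. Every hypothesis is either kernel-proved in this package or a
verbatim quotation of a PUBLISHED theorem with page reference. The manuscript(s) under audit are NOT citable for their own disputed steps — they are the thing
under adjudication; programme-internal (2001/route/tribunal) claims are never citable.»

WHY.  The road's one-loop kernels `TP μ ν z = hessKer K V W μ ν z = ½·tadpole K (W μ 0 ν z) − ½·bubble K (V μ 0) (V ν z)` are TWO-BOND objects (background bonds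
`(μ,0)` and `(ν,z)`), i.e. MIXED second variations, while the model theorems of `NestedStepLawMovingBorder` ∕ `KKTSecondVariation` are stated for ONE-parameter curves
(`secondVar A₀ Ȧ Ä = tr(A₀⁻¹Ä) − tr(A₀⁻¹ȦA₀⁻¹Ȧ)`).  Polarisation bridges them with NO calculus: for any `A₀` and jets `B, B′` (first, along the two bonds), `C, C′` (pure
second) and `D` (mixed second), `secondVar A₀ (B + B′) (C + 2•D + C′) − secondVar A₀ B C − secondVar A₀ B′ C′ = 2·mixedVar A₀ B B′ D` — so an identity
«composite = fine + block» holding for `secondVar` along the three directions `e_b`, `e_{b′}`, `e_b + e_{b′}` (three instances of the one-direction theorem, with the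
polynomial curves of design ROUTE T) holds for `mixedVar`, hence for the road's two-bond six loops.

CONTENTS: `mixedVar` (abbreviation), `mixedVar_self` (`mixedVar A B B C = secondVar A B C`), `secondVar_polarise` (the polarisation identity),
`mixedVar_symm_of_symm` (symmetry in the two first jets), **`mixedVar_comb_of_secondVar_comb`** (a linear «composite − fine − block = 0» relation for `secondVar`
along the three directions implies the same relation for `mixedVar`).
Provenance: road FP OWNER b2b-balaban-beta-d1-p3 gen 16 (prover-b2b-balaban-beta-d1-p3-g16-0), 2026-08-21; design ROUTE T (journal [D1P3-G16-ROUTE-T]).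
-/

noncomputable section

namespace Summit.QuantumFields.BalabanUV.Beta.FP.SecondVarPolarisation

open Matrix
open Summit.QuantumFields.BalabanUV.Beta.D1BFx.LogDetSecondVariation (secondVar)

variable {ι : Type*} [Fintype ι] [DecidableEq ι]

/-- [our object — an abbreviation asserting nothing] **THE MIXED ONE-LOOP FUNCTIONAL OF A TWO-BOND 2-JET** `(A₀; A_b, A_b′; A_bb′)`:
`mixedVar A₀ B B′ D := tr(A₀⁻¹D) − tr(A₀⁻¹B·A₀⁻¹B′)` — the two-slot twin of `secondVar` (`2·(½·tadpole − ½·bubble)` with two different first jets). -/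
def mixedVar (A₀ B B' D : Matrix ι ι ℝ) : ℝ :=
  (A₀⁻¹ * D).trace - (A₀⁻¹ * B * (A₀⁻¹ * B')).trace

/-- [folklore] On the diagonal the mixed functional IS `secondVar`. -/
theorem mixedVar_self (A₀ B C : Matrix ι ι ℝ) : mixedVar A₀ B B C = secondVar A₀ B C := rfl

/-- [folklore] The mixed functional is symmetric in its two first jets (trace cyclicity; no symmetry of the matrices needed). -/
theorem mixedVar_symm (A₀ B B' D : Matrix ι ι ℝ) : mixedVar A₀ B B' D = mixedVar A₀ B' B D := by
  unfold mixedVar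
  rw [Matrix.trace_mul_comm (A₀⁻¹ * B) (A₀⁻¹ * B')]

/-- [folklore] **POLARISATION**: `secondVar A₀ (B + B′) (C + 2•D + C′) − secondVar A₀ B C − secondVar A₀ B′ C′ = 2·mixedVar A₀ B B′ D`. -/
theorem secondVar_polarise (A₀ B B' C C' D : Matrix ι ι ℝ) :
    secondVar A₀ (B + B') (C + (2 : ℝ) • D + C') - secondVar A₀ B C - secondVar A₀ B' C' = 2 * mixedVar A₀ B B' D := by
  unfold secondVar mixedVar
  have hcyc : (A₀⁻¹ * B' * (A₀⁻¹ * B)).trace = (A₀⁻¹ * B * (A₀⁻¹ * B')).trace := Matrix.trace_mul_comm _ _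
  simp only [Matrix.mul_add, Matrix.add_mul, Matrix.mul_smul, Matrix.trace_add, Matrix.trace_smul, smul_eq_mul]
  rw [hcyc]
  ring

/-- [folklore] **A LINEAR RELATION AMONG `secondVar`s ALONG THE THREE DIRECTIONS `e_b`, `e_{b′}`, `e_b + e_{b′}` POLARISES**: if three systems (composite `N`,
fine `F`, block `G` — base points `N₀ F₀ G₀`) satisfy `secondVar N = secondVar F + secondVar G` along each of the three directions (first jets `·b`, `·b'`, `·b + ·b'`;
second jets `·bb`, `·b'b'`, `·bb + 2•·bb' + ·b'b'`), then `mixedVar N = mixedVar F + mixedVar G` for the two-bond jets. -/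
theorem mixedVar_comb_of_secondVar_comb {κ₁ κ₂ κ₃ : Type*} [Fintype κ₁] [DecidableEq κ₁] [Fintype κ₂] [DecidableEq κ₂] [Fintype κ₃] [DecidableEq κ₃]
    (N₀ Nb Nb' Nbb Nb'b' Nbb' : Matrix κ₁ κ₁ ℝ) (F₀ Fb Fb' Fbb Fb'b' Fbb' : Matrix κ₂ κ₂ ℝ) (G₀ Gb Gb' Gbb Gb'b' Gbb' : Matrix κ₃ κ₃ ℝ)
    (hb : secondVar N₀ Nb Nbb = secondVar F₀ Fb Fbb + secondVar G₀ Gb Gbb)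
    (hb' : secondVar N₀ Nb' Nb'b' = secondVar F₀ Fb' Fb'b' + secondVar G₀ Gb' Gb'b')
    (hsum : secondVar N₀ (Nb + Nb') (Nbb + (2 : ℝ) • Nbb' + Nb'b') =
      secondVar F₀ (Fb + Fb') (Fbb + (2 : ℝ) • Fbb' + Fb'b') + secondVar G₀ (Gb + Gb') (Gbb + (2 : ℝ) • Gbb' + Gb'b')) :
    mixedVar N₀ Nb Nb' Nbb' = mixedVar F₀ Fb Fb' Fbb' + mixedVar G₀ Gb Gb' Gbb' := by
  have hN := secondVar_polarise N₀ Nb Nb' Nbb Nb'b' Nbb'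
  have hF := secondVar_polarise F₀ Fb Fb' Fbb Fb'b' Fbb'
  have hG := secondVar_polarise G₀ Gb Gb' Gbb Gb'b' Gbb'
  linarith

end Summit.QuantumFields.BalabanUV.Beta.FP.SecondVarPolarisation

end
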